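import Summits.QuantumFields.BalabanUV.T4Continuum.Support.NE7SharpConstrainedGradientRow
import HarnessLib

/-!
# NE7SharpGreenOfLaplacian — THE SHARP BLOCK-MEAN-CONSTRAINED GREEN'S FUNCTION OF A LAPLACIAN SOURCE IS EXACT: `G_Q[(1 − Π′)Δf] = f − H(Q′f)` with
# `H = 𝒢′Q′*(Q′𝒢′Q′*)⁻¹` GAN24's HARD MINIMISER (the harmonic interpolant of the block means `Q′f`), hence its VALUE and η-GRADIENT ROWS
# WITHOUT DERIVATIVE LOSS: `‖G_Q[(1 − Π′)Δf]‖_∞ ≤ ‖f‖_∞ + C·‖Q′f‖_∞`, `‖∂_ν G_Q[(1 − Π′)Δf]‖_∞ ≤ ‖∂_νf‖_∞ + C·‖Q′f‖_∞` (memo ROAD-G100 §4 (4) (R7′))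

Cell `pub-balaban`, rung (B)+1 sub-cell t4, lineage `b2b-balaban-t4-ne7b-p1`, generation 150 (OWNER of BINDER row NE7b; junction service for the NE crew, ruling
R-OWNER-149-1 (2)).  A JUNCTION for row NE7 (node U5, which row NE7b serves through seam (ζ′)): memo `t4/b2b-balaban-t4-ne7-p1-g100/ROAD-G100.md` §4 (the curved
sup letter of the energy slice `𝒯_E(W)`, bootstrap at a point), step (4) (R7′): «the pure-gauge part `∂f` is handled EXACTLY (`∂·G_Q(1−P_𝒦)∂^*∂f = ∂(f − Π_𝒦-part)`:
`G_Q` inverts `Δ` on block-mean-zero functions — an algebraic identity of `NE7SharpConstrainedGradientRow`'s objects, to be typed)».  THIS FILE types it, with the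
precise «Π_𝒦-part»: NOT the block-constant projection `Π′f` (its Laplacian is not block-constant) but the HARMONIC INTERPOLANT `H(Q′f)` of the block means — GAN24's hard
minimiser `HardMinimiserOneStepSup.Mhard = Msoft·Savg⁻¹ = 𝒢′Q′*(Q′𝒢′Q′*)⁻¹` (the Dirichlet-energy minimiser with prescribed block means, `GalerkinPythagoras.dirichlet_Mhard_le`;
[B5] (1.103) as a text location).

THE OBJECTS (by their equations; `U = 1`, scalar, fine torus `Tor (fine n M)` over the unit torus `Tor M`).  `Q′ = B5Block118.QsOp n M` (block means), `Q′* = blkInj n M`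
(block-constant injection, `= n^d·Q′ᴴ`), `Π′ = ScalarBlockPoincare.PiS n M = Q′*Q′` (replace a field by its block means), `Δ = B5Action121.LapS (fine n M) n` (`= ∂ᴴ∂`, η-units),
`S = Savg n M a′ = a′Q′𝒢′Q′*`, `H = Mhard n M a′`.  SHARP PROBLEM of `NE7SharpConstrainedGradientRow` for a source `s`: `Q′ψ = 0 ∧ Δψ = s + Q′*e` (`ψ = G_Q s`, multiplier `e`;
`exists_sharp_solution`, `sharp_unique`, rows `sharp_sup_rows_cubic` in terms of `‖s‖_∞`).  For the LAPLACIAN source `s = Δf − Π′(Δf)` those rows cost `‖Δf‖_∞` — two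
derivatives.  HERE: the KKT identity of the hard minimiser `Δ(Hv) = Q′*(a′(S⁻¹v − v))` and `Q′H = 1` say that `ψ := f − H(Q′f)`, `e := Q′(Δf) − a′(S⁻¹ − 1)(Q′f)` SOLVE the sharp
problem for `s = (1 − Π′)Δf`; uniqueness makes it THE solution; the rows of `H` (`sup_Msoft`, `exists_sup_Savg_inv`, (L2) `scalarSup_DivG`) then bound `ψ` by `f` and `Q′f` ALONE.
WHAT ([folklore]; 0 def, 0 sorry; §1 every torus `Fin d`, §2 value rows every torus `Fin (d+1)`, gradient rows CUBIC tori — GAN24's (L2) is cubic).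
§1 `QsOp_mulVec_Mhard_mulVec` (`Q′(Hv) = v`), `LapS_mulVec_Mhard_eq_blkInj` (`Δ(Hv) = Q′*(a′·(S⁻¹v − v))`), `PiS_mulVec_eq_blkInj` (`Π′g = Q′*(Q′g)`),
   **`sharp_solution_laplacian_source`** (`(f − H(Q′f), Q′(Δf) − a′(S⁻¹(Q′f) − Q′f))` solves the sharp problem for `(1 − Π′)Δf`), **`sharp_laplacian_source_unique`** (every sharp
   solution `(ψ, e)` of that source IS that pair), **`sharp_laplacian_source_eq_self`** (`Q′f = 0 ⟹ ψ = f ∧ e = Q′(Δf)`: `G_Q(1 − Π′)Δ = 1` on `ker Q′`), `Mhard_mulVec_indep` ∕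
   **`Mhard_indep`** (the hard minimiser does not depend on the penalty weight `a′ > 0` — it is the unique field with block means `v` and block-constant-sourced Laplacian).
§2 `sup_Mhard` (`∃ C_H(d, a′) > 0`: `‖Hv‖_∞ ≤ C_H‖v‖_∞`, every torus, every `n`), `sup_sdiff_Mhard_cubic` (`∃ C(d, a′) > 0`: `‖∂_ν(Hv)‖_∞ ≤ C‖v‖_∞`, cubic tori, `n ≥ 1`, η-units),
   **`sharp_laplacian_source_sup`** (`‖ψ(x)‖ ≤ ‖f(x)‖ + C_H·‖Q′f‖_∞`, every torus), **`sharp_laplacian_source_gradient_cubic`** (`‖(∂_νψ)(x)‖ ≤ ‖(∂_νf)(x)‖ + C·‖Q′f‖_∞`, cubic),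
   **`sharp_laplacian_source_rows_cubic`** (packaged like `sharp_sup_rows_cubic`: `‖f‖_∞ ≤ b`, `‖∂_νf‖_∞ ≤ b₁` ⟹ `‖ψ‖_∞ ≤ (1 + C)·b`, `‖∂_νψ‖_∞ ≤ b₁ + C·b` — NO `‖Δf‖`).
§3 `gradOpH_gradOp_mulVec` (`∂ᴴ(∂f) = Δf`), **`sharp_gradOp_source_cubic`** (the vector-field reading: for the source `(1 − Π′)∂ᴴ(∂f)`, at every bond `‖(∂ψ)(i)‖ ≤ ‖(∂f)(i)‖ + C·‖Q′f‖_∞`).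
HONEST FRAMING (page 1): finite-lattice linear algebra over LANDED GAN24 ∕ NE7 theorems BY NAME; constants existential (GAN24's); `U = 1`, scalar, flat; the multiplier `e` is
given EXACTLY but its row is not restated (it carries `‖Q′(Δf)‖_∞`, one η-derivative of `f` by the divergence theorem on a block — not typed here; the road uses `∂ψ` only);
NOT the curved sup letter, NOT (S1), NOT NE7, nothing of row NE7b; spine 0∕9; finite T⁴ rung (B)+1 — NOT infinite volume, NOT mass gap, NOT BetaPertH, NOT Clay.
[Balaban1984PropagatorsI] (1.20) p. 20, (1.103) p. 34 are TEXT LOCATIONS for `Q′`, `H`; nothing printed is asserted.  Continuum YM on T⁴ ⇐ BetaPertH ∧ nine spine estimates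
(0/9 proved); BetaPertH ⇐ (D1) ∧ (D4) ∧ CAP+tail; G-an2-4 gates asym, D1 and NE2/3/4.
-/

set_option autoImplicit false

open scoped BigOperators Matrix ComplexConjugate

namespace Summit.QuantumFields.BalabanUV.T4Continuum.NE7SharpGreenOfLaplacian

open Literature.MathematicalPhysics.QuantumFieldTheory.Balaban1983to89
open B5Prop11Plancherel (Tor fine)
open B5Action121 (LapS sdiff GradOp GradOp_mulVec GradOp_conjTranspose_mul_GradOp)
open B5Block118 (QsOp)
open Summit.QuantumFields.BalabanUV.T4Continuum.ScalarAveragedPropagator (DeltaPs Gps)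
open Summit.QuantumFields.BalabanUV.T4Continuum.ScalarBlockPoincare (PiS)
open Summit.QuantumFields.BalabanUV.Beta.GAN24.SoftMinimiserOneStepSup (blkInj blkInj_mulVec Msoft Msoft_mulVec DeltaPs_mulVec_Msoft
  norm_smul_blkInj_mulVec_le)
open Summit.QuantumFields.BalabanUV.Beta.GAN24.HardMinimiserOneStepSup (Savg Mhard isUnit_det_Savg QsOp_mul_Mhard Mhard_mulVec blkInj_eq_smul
  norm_QsOp_mulVec_le)
open Summit.QuantumFields.BalabanUV.Beta.GAN24.ScalarZerothLetterTorus (sup_Msoft)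
open Summit.QuantumFields.BalabanUV.Beta.GAN24.ScalarSupLettersCubicHolds (scalarSup_DivG)
open Summit.QuantumFields.BalabanUV.Beta.GAN24.SavgInverseUniform (exists_sup_Savg_inv)
open NE7SharpConstrainedGradientRow (sharp_unique)

noncomputable section

/-! ## §1 The sharp solution of a Laplacian source, exactly (every torus) -/

section Algebra

variable {d : ℕ} (n : ℕ) [NeZero n] (M : Fin d → ℕ) [∀ μ, NeZero (M μ)]

/-- `Q′(Hv) = v` (`Q′H = 1`). [folklore] -/
theorem QsOp_mulVec_Mhard_mulVec {a' : ℝ} (ha' : 0 < a') (v : Tor M → ℂ) :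
    QsOp n M *ᵥ (Mhard n M a' *ᵥ v) = v := by
  rw [Matrix.mulVec_mulVec, QsOp_mul_Mhard n M ha', Matrix.one_mulVec]

/-- `Π′g = Q′*(Q′g)`: the block projection is «inject the block means». [folklore] -/
theorem PiS_mulVec_eq_blkInj (g : Tor (fine n M) → ℂ) : PiS n M *ᵥ g = blkInj n M *ᵥ (QsOp n M *ᵥ g) := by
  rw [PiS, Matrix.smul_mulVec, ← Matrix.mulVec_mulVec, blkInj_eq_smul, Matrix.smul_mulVec]

/-- **THE KKT IDENTITY OF THE HARD MINIMISER, `Q′*`-form**: `Δ(Hv) = Q′*(a′·(S⁻¹v − v))` — the Laplacian of the harmonic interpolant is BLOCK-CONSTANT (from `Δ′_{a′}(Mw) = a′Q′*w`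
at `w = S⁻¹v`, `Δ′ = Δ + a′Π′`, `Π′(Hv) = Q′*v`; cf. `GalerkinPythagoras.LapS_mulVec_Mhard`, the `Q′ᴴ`-form). [folklore] -/
theorem LapS_mulVec_Mhard_eq_blkInj {a' : ℝ} (ha' : 0 < a') (v : Tor M → ℂ) :
    LapS (fine n M) (n : ℂ) *ᵥ (Mhard n M a' *ᵥ v) = blkInj n M *ᵥ ((a' : ℂ) • ((Savg n M a')⁻¹ *ᵥ v - v)) := by
  have hD : DeltaPs n M a' *ᵥ (Mhard n M a' *ᵥ v) = (a' : ℂ) • (blkInj n M *ᵥ ((Savg n M a')⁻¹ *ᵥ v)) := by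
    rw [Mhard_mulVec, DeltaPs_mulVec_Msoft n M ha']
  have hPi : PiS n M *ᵥ (Mhard n M a' *ᵥ v) = blkInj n M *ᵥ v := by
    rw [PiS_mulVec_eq_blkInj, QsOp_mulVec_Mhard_mulVec n M ha']
  have hsplit : LapS (fine n M) (n : ℂ) *ᵥ (Mhard n M a' *ᵥ v)
      = DeltaPs n M a' *ᵥ (Mhard n M a' *ᵥ v) - (a' : ℂ) • (PiS n M *ᵥ (Mhard n M a' *ᵥ v)) := by
    rw [DeltaPs, Matrix.add_mulVec, Matrix.smul_mulVec]; abel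
  rw [hsplit, hD, hPi, ← smul_sub, ← Matrix.mulVec_sub, ← Matrix.mulVec_smul]

/-- **THE SHARP SOLUTION OF A LAPLACIAN SOURCE** (`a′ > 0`): `ψ := f − H(Q′f)` and `e := Q′(Δf) − a′·(S⁻¹(Q′f) − Q′f)` satisfy `Q′ψ = 0` and `Δψ = (Δf − Π′(Δf)) + Q′*e` — i.e.
`(ψ, e)` solves the sharp block-mean-constrained problem of `NE7SharpConstrainedGradientRow` for the source `(1 − Π′)Δf`. [folklore] -/
theorem sharp_solution_laplacian_source {a' : ℝ} (ha' : 0 < a') (f : Tor (fine n M) → ℂ) :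
    QsOp n M *ᵥ (f - Mhard n M a' *ᵥ (QsOp n M *ᵥ f)) = 0 ∧
    LapS (fine n M) (n : ℂ) *ᵥ (f - Mhard n M a' *ᵥ (QsOp n M *ᵥ f))
      = (LapS (fine n M) (n : ℂ) *ᵥ f - PiS n M *ᵥ (LapS (fine n M) (n : ℂ) *ᵥ f))
        + blkInj n M *ᵥ (QsOp n M *ᵥ (LapS (fine n M) (n : ℂ) *ᵥ f)
            - (a' : ℂ) • ((Savg n M a')⁻¹ *ᵥ (QsOp n M *ᵥ f) - QsOp n M *ᵥ f)) := by
  refine ⟨?_, ?_⟩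
  · rw [Matrix.mulVec_sub, QsOp_mulVec_Mhard_mulVec n M ha', sub_self]
  · rw [Matrix.mulVec_sub, LapS_mulVec_Mhard_eq_blkInj n M ha', PiS_mulVec_eq_blkInj, Matrix.mulVec_sub (blkInj n M)]
    abel

/-- **UNIQUENESS: EVERY SHARP SOLUTION OF THE LAPLACIAN SOURCE IS `f − H(Q′f)`** (`a′ > 0`; `sharp_unique` on the difference): `Q′ψ = 0`, `Δψ = (Δf − Π′(Δf)) + Q′*e` ⟹
`ψ = f − H(Q′f)` and `e = Q′(Δf) − a′·(S⁻¹(Q′f) − Q′f)`.  This is «`G_Q[(1 − P_𝒦)∂ᴴ∂f] = f − H(Q′f)`» of memo ROAD-G100 §4 (4). [folklore] -/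
theorem sharp_laplacian_source_unique {a' : ℝ} (ha' : 0 < a') (f : Tor (fine n M) → ℂ) {ψ : Tor (fine n M) → ℂ} {e : Tor M → ℂ}
    (hQ : QsOp n M *ᵥ ψ = 0)
    (hL : LapS (fine n M) (n : ℂ) *ᵥ ψ = (LapS (fine n M) (n : ℂ) *ᵥ f - PiS n M *ᵥ (LapS (fine n M) (n : ℂ) *ᵥ f)) + blkInj n M *ᵥ e) :
    ψ = f - Mhard n M a' *ᵥ (QsOp n M *ᵥ f) ∧
      e = QsOp n M *ᵥ (LapS (fine n M) (n : ℂ) *ᵥ f) - (a' : ℂ) • ((Savg n M a')⁻¹ *ᵥ (QsOp n M *ᵥ f) - QsOp n M *ᵥ f) := by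
  obtain ⟨hQ₀, hL₀⟩ := sharp_solution_laplacian_source n M ha' f
  have hQd : QsOp n M *ᵥ (ψ - (f - Mhard n M a' *ᵥ (QsOp n M *ᵥ f))) = 0 := by
    rw [Matrix.mulVec_sub (QsOp n M) ψ, hQ, hQ₀, sub_zero]
  have hLd : LapS (fine n M) (n : ℂ) *ᵥ (ψ - (f - Mhard n M a' *ᵥ (QsOp n M *ᵥ f)))
      = blkInj n M *ᵥ (e - (QsOp n M *ᵥ (LapS (fine n M) (n : ℂ) *ᵥ f)
          - (a' : ℂ) • ((Savg n M a')⁻¹ *ᵥ (QsOp n M *ᵥ f) - QsOp n M *ᵥ f))) := by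
    rw [Matrix.mulVec_sub (LapS (fine n M) (n : ℂ)) ψ, hL, hL₀,
      Matrix.mulVec_sub (blkInj n M) e (QsOp n M *ᵥ (LapS (fine n M) (n : ℂ) *ᵥ f)
        - (a' : ℂ) • ((Savg n M a')⁻¹ *ᵥ (QsOp n M *ᵥ f) - QsOp n M *ᵥ f))]
    abel
  obtain ⟨h1, h2⟩ := sharp_unique n M hQd hLd
  exact ⟨sub_eq_zero.mp h1, sub_eq_zero.mp h2⟩

/-- **`G_Q(1 − Π′)Δ = 1` ON `ker Q′`**: if `Q′f = 0`, every sharp solution `(ψ, e)` of the source `Δf − Π′(Δf)` has `ψ = f` and `e = Q′(Δf)`. [folklore] -/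
theorem sharp_laplacian_source_eq_self (f : Tor (fine n M) → ℂ) (hf : QsOp n M *ᵥ f = 0) {ψ : Tor (fine n M) → ℂ} {e : Tor M → ℂ}
    (hQ : QsOp n M *ᵥ ψ = 0)
    (hL : LapS (fine n M) (n : ℂ) *ᵥ ψ = (LapS (fine n M) (n : ℂ) *ᵥ f - PiS n M *ᵥ (LapS (fine n M) (n : ℂ) *ᵥ f)) + blkInj n M *ᵥ e) :
    ψ = f ∧ e = QsOp n M *ᵥ (LapS (fine n M) (n : ℂ) *ᵥ f) := by
  obtain ⟨h1, h2⟩ := sharp_laplacian_source_unique n M one_pos f hQ hL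
  rw [hf, Matrix.mulVec_zero, sub_zero] at h1
  rw [hf, Matrix.mulVec_zero, sub_zero, smul_zero, sub_zero] at h2
  exact ⟨h1, h2⟩

/-- The hard minimiser applied to block data does not depend on the penalty weight: `H_{a′}v = H_{a″}v` for all `a′, a″ > 0` (both are sharp-type: `Q′h = v`, `Δh ∈ range Q′*`;
`sharp_unique` on the difference). [folklore] -/
theorem Mhard_mulVec_indep {a' a'' : ℝ} (ha' : 0 < a') (ha'' : 0 < a'') (v : Tor M → ℂ) :
    Mhard n M a' *ᵥ v = Mhard n M a'' *ᵥ v := by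
  have hQd : QsOp n M *ᵥ (Mhard n M a' *ᵥ v - Mhard n M a'' *ᵥ v) = 0 := by
    rw [Matrix.mulVec_sub, QsOp_mulVec_Mhard_mulVec n M ha', QsOp_mulVec_Mhard_mulVec n M ha'', sub_self]
  have hLd : LapS (fine n M) (n : ℂ) *ᵥ (Mhard n M a' *ᵥ v - Mhard n M a'' *ᵥ v)
      = blkInj n M *ᵥ ((a' : ℂ) • ((Savg n M a')⁻¹ *ᵥ v - v) - (a'' : ℂ) • ((Savg n M a'')⁻¹ *ᵥ v - v)) := by
    rw [Matrix.mulVec_sub, LapS_mulVec_Mhard_eq_blkInj n M ha', LapS_mulVec_Mhard_eq_blkInj n M ha'', Matrix.mulVec_sub]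
  exact sub_eq_zero.mp (sharp_unique n M hQd hLd).1

/-- **THE HARD MINIMISER IS `a′`-INDEPENDENT** as a matrix: `Mhard n M a′ = Mhard n M a″` (`a′, a″ > 0`). [folklore] -/
theorem Mhard_indep {a' a'' : ℝ} (ha' : 0 < a') (ha'' : 0 < a'') : Mhard n M a' = Mhard n M a'' := by
  have h : Matrix.toLin' (Mhard n M a') = Matrix.toLin' (Mhard n M a'') :=
    LinearMap.ext fun v => by rw [Matrix.toLin'_apply, Matrix.toLin'_apply, Mhard_mulVec_indep n M ha' ha'' v]
  exact Matrix.toLin'.injective h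

end Algebra

/-! ## §2 The rows: value (every torus) and η-gradient (cubic tori) of the sharp solution of a Laplacian source — no derivative loss -/

section Rows

variable (d : ℕ)

/-- **THE HARD MINIMISER IS SUP-BOUNDED, EVERY TORUS, UNIFORMLY IN `n`**: `∃ C_H(d, a′) > 0`, `‖v‖_∞ ≤ b ⟹ ‖(Hv)(x)‖ ≤ C_H·b` (`H = M·S⁻¹`: `sup_Msoft` and
`exists_sup_Savg_inv`). [folklore] -/
theorem sup_Mhard {a' : ℝ} (ha' : 0 < a') :
    ∃ C : ℝ, 0 < C ∧ ∀ (n : ℕ) [NeZero n] (M : Fin (d + 1) → ℕ) [∀ μ, NeZero (M μ)]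
      (v : Tor M → ℂ) (b : ℝ), (∀ y, ‖v y‖ ≤ b) → ∀ x, ‖(Mhard n M a' *ᵥ v) x‖ ≤ C * b := by
  obtain ⟨C₀, hC₀, hMs⟩ := sup_Msoft d ha'
  obtain ⟨σ, hσ, hS⟩ := exists_sup_Savg_inv d ha'
  refine ⟨a' * C₀ * σ, by positivity, fun n _ M _ v b hv x => ?_⟩
  rw [Mhard_mulVec]
  calc ‖(Msoft n M a' *ᵥ ((Savg n M a')⁻¹ *ᵥ v)) x‖ ≤ a' * C₀ * (σ * b) := hMs n M _ _ (hS n M v b hv) x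
    _ = a' * C₀ * σ * b := by ring

/-- **THE η-GRADIENT OF THE HARD MINIMISER IS SUP-BOUNDED ON CUBIC TORI, UNIFORMLY IN `n ≥ 1`**: `∃ C(d, a′) > 0`, `‖v‖_∞ ≤ b ⟹ ‖(∂_ν(Hv))(x)‖ ≤ C·b` (η-units; unit-lattice
reading `‖∇(Hv)‖ ≤ C·b∕n`): `Hv = 𝒢′(a′·Q′*S⁻¹v)` and (L2) `scalarSup_DivG`. [folklore] -/
theorem sup_sdiff_Mhard_cubic {a' : ℝ} (ha' : 0 < a') :
    ∃ C : ℝ, 0 < C ∧ ∀ (n N₀ : ℕ) [NeZero n] [NeZero N₀], 1 ≤ n →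
      ∀ (ν : Fin (d + 1)) (v : Tor (fun _ : Fin (d + 1) => N₀) → ℂ) (b : ℝ), (∀ y, ‖v y‖ ≤ b) →
        ∀ x, ‖(sdiff (fine n (fun _ : Fin (d + 1) => N₀)) (n : ℂ) ν *ᵥ (Mhard n (fun _ : Fin (d + 1) => N₀) a' *ᵥ v)) x‖ ≤ C * b := by
  obtain ⟨C₁, hC₁, hD⟩ := scalarSup_DivG (d := d) ha'
  obtain ⟨σ, hσ, hS⟩ := exists_sup_Savg_inv d ha'
  refine ⟨C₁ * a' * σ, by positivity, fun n N₀ _ _ hn ν v b hv x => ?_⟩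
  have hsrc : ∀ y, ‖((a' : ℂ) • (blkInj n (fun _ : Fin (d + 1) => N₀) *ᵥ ((Savg n (fun _ : Fin (d + 1) => N₀) a')⁻¹ *ᵥ v))) y‖ ≤ a' * (σ * b) :=
    fun y => norm_smul_blkInj_mulVec_le n _ ha'.le _ (hS n _ v b hv) y
  rw [Mhard_mulVec, Msoft_mulVec]
  calc ‖(sdiff (fine n (fun _ : Fin (d + 1) => N₀)) (n : ℂ) ν *ᵥ (Gps n (fun _ : Fin (d + 1) => N₀) a' *ᵥ
          ((a' : ℂ) • (blkInj n (fun _ : Fin (d + 1) => N₀) *ᵥ ((Savg n (fun _ : Fin (d + 1) => N₀) a')⁻¹ *ᵥ v))))) x‖ ≤ C₁ * (a' * (σ * b)) :=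
        hD n N₀ hn ν _ _ hsrc x
    _ = C₁ * a' * σ * b := by ring

/-- **THE VALUE ROW OF THE SHARP SOLUTION OF A LAPLACIAN SOURCE, EVERY TORUS — NO DERIVATIVE LOSS**: `∃ C_H(d) > 0` such that for every `n`, every torus, every `f` with
`‖Q′f‖_∞ ≤ b_Q` and every sharp solution `(ψ, e)` of the source `Δf − Π′(Δf)`: `‖ψ(x)‖ ≤ ‖f(x)‖ + C_H·b_Q` at every site. [folklore] -/
theorem sharp_laplacian_source_sup :
    ∃ C : ℝ, 0 < C ∧ ∀ (n : ℕ) [NeZero n] (M : Fin (d + 1) → ℕ) [∀ μ, NeZero (M μ)]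
      (f ψ : Tor (fine n M) → ℂ) (e : Tor M → ℂ) (bQ : ℝ), (∀ y, ‖(QsOp n M *ᵥ f) y‖ ≤ bQ) →
      QsOp n M *ᵥ ψ = 0 →
      LapS (fine n M) (n : ℂ) *ᵥ ψ = (LapS (fine n M) (n : ℂ) *ᵥ f - PiS n M *ᵥ (LapS (fine n M) (n : ℂ) *ᵥ f)) + blkInj n M *ᵥ e →
        ∀ x, ‖ψ x‖ ≤ ‖f x‖ + C * bQ := by
  obtain ⟨C, hC, hH⟩ := sup_Mhard d one_pos
  refine ⟨C, hC, fun n _ M _ f ψ e bQ hfQ hQ hL x => ?_⟩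
  rw [(sharp_laplacian_source_unique n M one_pos f hQ hL).1, Pi.sub_apply]
  exact (norm_sub_le _ _).trans (add_le_add le_rfl (hH n M _ bQ hfQ x))

/-- **THE η-GRADIENT ROW OF THE SHARP SOLUTION OF A LAPLACIAN SOURCE, CUBIC TORI — NO DERIVATIVE LOSS**: `∃ C(d) > 0` such that for every `n ≥ 1`, every cubic torus, every `f`
with `‖Q′f‖_∞ ≤ b_Q` and every sharp solution `(ψ, e)` of the source `Δf − Π′(Δf)`: `‖(∂_νψ)(x)‖ ≤ ‖(∂_νf)(x)‖ + C·b_Q` for every direction `ν` and site `x` (η-units).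
This is the row the bootstrap of memo ROAD-G100 §4 reads: the pure-gauge corrector's contribution to `∂μ` is `∂f − ∂H(Q′f)`, the second term `O(‖Q′f‖_∞)` in η-units
(`O(‖f‖_∞∕M)` on the unit lattice). [folklore] -/
theorem sharp_laplacian_source_gradient_cubic :
    ∃ C : ℝ, 0 < C ∧ ∀ (n N₀ : ℕ) [NeZero n] [NeZero N₀], 1 ≤ n →
      ∀ (f ψ : Tor (fine n (fun _ : Fin (d + 1) => N₀)) → ℂ) (e : Tor (fun _ : Fin (d + 1) => N₀) → ℂ) (bQ : ℝ),
        (∀ y, ‖(QsOp n (fun _ : Fin (d + 1) => N₀) *ᵥ f) y‖ ≤ bQ) →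
        QsOp n (fun _ : Fin (d + 1) => N₀) *ᵥ ψ = 0 →
        LapS (fine n (fun _ : Fin (d + 1) => N₀)) (n : ℂ) *ᵥ ψ
          = (LapS (fine n (fun _ : Fin (d + 1) => N₀)) (n : ℂ) *ᵥ f
              - PiS n (fun _ : Fin (d + 1) => N₀) *ᵥ (LapS (fine n (fun _ : Fin (d + 1) => N₀)) (n : ℂ) *ᵥ f))
            + blkInj n (fun _ : Fin (d + 1) => N₀) *ᵥ e →
        ∀ (ν : Fin (d + 1)) (x : Tor (fine n (fun _ : Fin (d + 1) => N₀))),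
          ‖(sdiff (fine n (fun _ : Fin (d + 1) => N₀)) (n : ℂ) ν *ᵥ ψ) x‖
            ≤ ‖(sdiff (fine n (fun _ : Fin (d + 1) => N₀)) (n : ℂ) ν *ᵥ f) x‖ + C * bQ := by
  obtain ⟨C, hC, hH⟩ := sup_sdiff_Mhard_cubic d one_pos
  refine ⟨C, hC, fun n N₀ _ _ hn f ψ e bQ hfQ hQ hL ν x => ?_⟩
  rw [(sharp_laplacian_source_unique n _ one_pos f hQ hL).1, Matrix.mulVec_sub, Pi.sub_apply]
  exact (norm_sub_le _ _).trans (add_le_add le_rfl (hH n N₀ hn ν _ bQ hfQ x))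

/-- **THE ROWS OF `G_Q[(1 − Π′)Δf]`, PACKAGED** (the shape of `NE7SharpConstrainedGradientRow.sharp_sup_rows_cubic`, with the source's `‖s‖_∞` REPLACED by `‖f‖_∞` and
`‖∂f‖_∞`): `∃ C(d) > 0` such that on every cubic torus, every `n ≥ 1`, for `‖f‖_∞ ≤ b`, `‖∂_νf‖_∞ ≤ b₁` (all `ν`) and every sharp solution `(ψ, e)` of the source `Δf − Π′(Δf)`:
`‖ψ‖_∞ ≤ (1 + C)·b` and `‖∂_νψ‖_∞ ≤ b₁ + C·b` — no `‖Δf‖` anywhere. [folklore] -/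
theorem sharp_laplacian_source_rows_cubic :
    ∃ C : ℝ, 0 < C ∧ ∀ (n N₀ : ℕ) [NeZero n] [NeZero N₀], 1 ≤ n →
      ∀ (f ψ : Tor (fine n (fun _ : Fin (d + 1) => N₀)) → ℂ) (e : Tor (fun _ : Fin (d + 1) => N₀) → ℂ) (b b₁ : ℝ),
        (∀ x, ‖f x‖ ≤ b) →
        (∀ (ν : Fin (d + 1)) (x : Tor (fine n (fun _ : Fin (d + 1) => N₀))), ‖(sdiff (fine n (fun _ : Fin (d + 1) => N₀)) (n : ℂ) ν *ᵥ f) x‖ ≤ b₁) →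
        QsOp n (fun _ : Fin (d + 1) => N₀) *ᵥ ψ = 0 →
        LapS (fine n (fun _ : Fin (d + 1) => N₀)) (n : ℂ) *ᵥ ψ
          = (LapS (fine n (fun _ : Fin (d + 1) => N₀)) (n : ℂ) *ᵥ f
              - PiS n (fun _ : Fin (d + 1) => N₀) *ᵥ (LapS (fine n (fun _ : Fin (d + 1) => N₀)) (n : ℂ) *ᵥ f))
            + blkInj n (fun _ : Fin (d + 1) => N₀) *ᵥ e →
        (∀ x, ‖ψ x‖ ≤ (1 + C) * b) ∧
          ∀ (ν : Fin (d + 1)) (x : Tor (fine n (fun _ : Fin (d + 1) => N₀))),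
            ‖(sdiff (fine n (fun _ : Fin (d + 1) => N₀)) (n : ℂ) ν *ᵥ ψ) x‖ ≤ b₁ + C * b := by
  obtain ⟨C₀, hC₀, h0⟩ := sharp_laplacian_source_sup d
  obtain ⟨C₁, hC₁, h1⟩ := sharp_laplacian_source_gradient_cubic d
  refine ⟨C₀ + C₁, by positivity, fun n N₀ _ _ hn f ψ e b b₁ hf hf₁ hQ hL => ?_⟩
  have hb : 0 ≤ b := (norm_nonneg _).trans (hf 0)
  have hfQ : ∀ y, ‖(QsOp n (fun _ : Fin (d + 1) => N₀) *ᵥ f) y‖ ≤ b := fun y => norm_QsOp_mulVec_le n _ f hf y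
  refine ⟨fun x => ?_, fun ν x => ?_⟩
  · calc ‖ψ x‖ ≤ ‖f x‖ + C₀ * b := h0 n _ f ψ e b hfQ hQ hL x
      _ ≤ b + (C₀ + C₁) * b := add_le_add (hf x) (by nlinarith)
      _ = (1 + (C₀ + C₁)) * b := by ring
  · calc ‖(sdiff (fine n (fun _ : Fin (d + 1) => N₀)) (n : ℂ) ν *ᵥ ψ) x‖
        ≤ ‖(sdiff (fine n (fun _ : Fin (d + 1) => N₀)) (n : ℂ) ν *ᵥ f) x‖ + C₁ * b := h1 n N₀ hn f ψ e b hfQ hQ hL ν x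
      _ ≤ b₁ + (C₀ + C₁) * b := add_le_add (hf₁ ν x) (by nlinarith)

end Rows

/-! ## §3 The vector-field reading: the pure-gauge source `∂f`, `Δf = ∂ᴴ(∂f)`, read bond by bond -/

section Gauge

variable (d : ℕ)

/-- `∂ᴴ(∂f) = Δf`. [folklore] -/
theorem gradOpH_gradOp_mulVec {d' : ℕ} (n : ℕ) [NeZero n] (M : Fin d' → ℕ) [∀ μ, NeZero (M μ)] (f : Tor (fine n M) → ℂ) :
    (GradOp (fine n M) (n : ℂ))ᴴ *ᵥ (GradOp (fine n M) (n : ℂ) *ᵥ f) = LapS (fine n M) (n : ℂ) *ᵥ f := by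
  rw [Matrix.mulVec_mulVec, GradOp_conjTranspose_mul_GradOp]

/-- **THE PURE-GAUGE SOURCE, BOND BY BOND (memo ROAD-G100 §4 (4) (R7′) as read)**: `∃ C(d) > 0` such that on every cubic torus, every `n ≥ 1`, for every scalar `f` with
`‖Q′f‖_∞ ≤ b_Q` and every sharp solution `(ψ, e)` of the source `(1 − Π′)∂ᴴ(∂f)` (`Q′ψ = 0`, `Δψ = (∂ᴴ∂f − Π′∂ᴴ∂f) + Q′*e`): at EVERY bond `i`,
`‖(∂ψ)(i)‖ ≤ ‖(∂f)(i)‖ + C·b_Q` — the gradient of `G_Q[(1 − Π′)∂ᴴ(∂f)]` is the pure gauge `∂f` itself up to `C·‖Q′f‖_∞` (η-units). [folklore] -/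
theorem sharp_gradOp_source_cubic :
    ∃ C : ℝ, 0 < C ∧ ∀ (n N₀ : ℕ) [NeZero n] [NeZero N₀], 1 ≤ n →
      ∀ (f ψ : Tor (fine n (fun _ : Fin (d + 1) => N₀)) → ℂ) (e : Tor (fun _ : Fin (d + 1) => N₀) → ℂ) (bQ : ℝ),
        (∀ y, ‖(QsOp n (fun _ : Fin (d + 1) => N₀) *ᵥ f) y‖ ≤ bQ) →
        QsOp n (fun _ : Fin (d + 1) => N₀) *ᵥ ψ = 0 →
        LapS (fine n (fun _ : Fin (d + 1) => N₀)) (n : ℂ) *ᵥ ψ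
          = ((GradOp (fine n (fun _ : Fin (d + 1) => N₀)) (n : ℂ))ᴴ *ᵥ (GradOp (fine n (fun _ : Fin (d + 1) => N₀)) (n : ℂ) *ᵥ f)
              - PiS n (fun _ : Fin (d + 1) => N₀) *ᵥ
                  ((GradOp (fine n (fun _ : Fin (d + 1) => N₀)) (n : ℂ))ᴴ *ᵥ (GradOp (fine n (fun _ : Fin (d + 1) => N₀)) (n : ℂ) *ᵥ f)))
            + blkInj n (fun _ : Fin (d + 1) => N₀) *ᵥ e →
        ∀ i : Tor (fine n (fun _ : Fin (d + 1) => N₀)) × Fin (d + 1),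
          ‖(GradOp (fine n (fun _ : Fin (d + 1) => N₀)) (n : ℂ) *ᵥ ψ) i‖
            ≤ ‖(GradOp (fine n (fun _ : Fin (d + 1) => N₀)) (n : ℂ) *ᵥ f) i‖ + C * bQ := by
  obtain ⟨C, hC, h1⟩ := sharp_laplacian_source_gradient_cubic d
  refine ⟨C, hC, fun n N₀ _ _ hn f ψ e bQ hfQ hQ hL i => ?_⟩
  rw [gradOpH_gradOp_mulVec] at hL
  obtain ⟨x, ν⟩ := i
  rw [GradOp_mulVec, GradOp_mulVec]
  exact h1 n N₀ hn f ψ e bQ hfQ hQ hL ν x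

end Gauge

end

end Summit.QuantumFields.BalabanUV.T4Continuum.NE7SharpGreenOfLaplacian
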